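import Literature.AlgebraicGeometry.Limits.LocalizationRelativeSchemeSpread   -- ★ LocApprox: `exists_whiskerLeft_comp_eq`, `overStage`, `whiskerLeft_π_overStage`, `exists_stage_res_eq_res`
import Literature.AlgebraicGeometry.Motives.IntegralModelRestrictScalars       -- ★ `IntegralModel`, `SchemeOver.restrictScalars`, `locallyOfFinitePresentation_specMap_ringOfIntegers`
import HarnessLib

/-!
# The sheet structure of an integral model of a restricted scheme, SPREAD TO A STAGE
# (EGA IV₃ 8.8.2 (i): the `Spec B`-structure `𝓜 ⊗ D(t) → Spec B ⊗ D(t)` with prescribed generic value)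

Topic `Literature/AlgebraicGeometry/Motives` (§2–§3, namespace `Literature.AlgebraicGeometry.Motives.IntegralModel`) with a LocApprox
preamble (§1, namespace `Literature.AlgebraicGeometry.Limits.LocApprox`).  THEOREMS ONLY (no definition, no named fact, no instance, no
notation, no `sorry`).  Cell `hodgecm-mathlib` (D-0151), P6 «MOD programme», half A line L4 (socket `stub_SPREAD` of the P-LINE
`Cruxes/HLiu418/Lines/F0_P6a_PELInputs.lean`, closer leaf `Lines/F0_P6a_PELSpread.lean` socket `stub_INJ0`; LEAD F0P6-plan (g3) «M-55»):
organ **(GS-3a) «THE `Fᵢ`-STRUCTURE AT A STAGE»** of A-p14 (g35)'s census `CENSUS-stubINJ0-globalfamily.v2` §1 — the structure map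
`q′ : 𝓜.total ⊗ D(t) → Spec 𝓞 Fᵢ ⊗ D(t)` over which ★ (GS-3) `AbelianSchemeOver.exists_finset_forall_eq_of_tupleIsoAt` is applied with
`B := 𝓞 Fᵢ` (the cofinite passage for `inj₀` runs PER SHEET).  `--supports stmt-HodgeConjecture-24832`, count-neutral.  HONEST LABEL: HC_CM is
proved only modulo the 2 remaining named inputs (hLiu418 24832, h413 24833) until rung 0 closes; this file is general scheme theory and
discharges none of them.

THE MATHEMATICS ([EGAIV3] Thm. 8.8.2 (i); [GortzWedhorn2020] Thm. 10.63 (p. 328); [StacksProject] Tag 01ZC).  `A` a ring, `S ⊆ A` a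
submonoid, `K = A_S`, `Spec K = lim_t D(t)` (`D(t) = Spec A[1∕t]`, ★ `LocalizationDiagram`).  §1: for `Y → Spec A` quasi-compact and
quasi-separated and `P → Spec A` locally of finite presentation, EVERY `Spec K`-morphism `h_K : Y ⊗ Spec K → P ⊗ Spec K` is the generic value
of a `D(t)`-morphism `h : Y ⊗ D(t) → P ⊗ D(t)` for some stage `t` (`(Y ◁ leg_t) ≫ h = h_K ≫ (P ◁ leg_t)`; ★ `exists_whiskerLeft_comp_eq` on
the first component, paired with the projection by ★ `overStage`) — the «given generic value, `Y` by value» head that ★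
`LocalizationRelativeSchemeSpread` (which CONSTRUCTS `Y`, `exists_stage_model`) leaves implicit; uniqueness at a finer stage is ★
`exists_stage_res_eq_res`.  §2: let `A → K`, `B → L`, `A → B`, `K → L` be a square of rings (`K`, `L` fields), `Z` an `L`-scheme and `𝓜` an
integral model over `A` of `Z` REGARDED over `K` (★ `SchemeOver.restrictScalars K Z`; for `Z = X ⊗_K L` this is the Galois thickening
`(thickening K L).obj X`, ★ `thickening_obj_eq_restrictScalars`), with `𝓜.total` quasi-compact quasi-separated and `Spec B → Spec A` locally
of finite presentation.  The SHEET STRUCTURE of the generic fibre — `Z → Spec L → Spec B` read through `𝓜.genericIso` — is an `A`-morphism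
`𝓜.total ⊗ Spec K → Spec B`; by §1 it spreads: THERE IS A STAGE `t` AND A `D(t)`-MORPHISM `h : 𝓜.total ⊗ D(t) → Spec B ⊗ D(t)` WHOSE GENERIC
VALUE, composed with the projection to `Spec B`, IS `𝓜.genericIso ≫ (Z → Spec L → Spec B)` (`exists_stage_sheetStructure`).  §3: the number-field
reading `A = 𝓞 F`, `K = F`, `B = 𝓞 Fᵢ`, `L = Fᵢ`, `S = (𝓞 F)⁰` (★ `locallyOfFinitePresentation_specMap_ringOfIntegers` discharges the finiteness),
and the THICKENING form for a model `𝓜 : IntegralModel (𝓞 F) F ((thickening F Fᵢ).obj X)` — the P-LINE's binder shape — whose sheet structure is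
`pr₂ : X ×_F Spec Fᵢ → Spec Fᵢ`.

CONSUMER (leaf `stub_INJ0`, A-p14 census §1): `q′ := h`, `q := h.left ≫ pr₁ : (𝓜.total ⊗ D(t)).left → Spec 𝓞 Fᵢ`; (GS-3c) two generic
points with the same `q`-composite lie on the same sheet (the displayed generic value + ★ `AlgPoints.embOfPoint`); (GS-3d) the two reductions
in `PELInj0LawAt` share their `q`-composite.

## References
* [EGAIV3] A. Grothendieck, J. Dieudonné, *ÉGA* IV₃, Publ. Math. IHÉS 28 (1966), Thm. 8.8.2 (i) (p. 28).
* [GortzWedhorn2020] U. Görtz, T. Wedhorn, *Algebraic Geometry I: Schemes*, 2nd ed. (2020), Thm. 10.63 (p. 328), Prop. 4.16 and §(4.8).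
* [StacksProject] The Stacks project, Tag 01ZC (Limits of schemes, Prop. 32.6.1).
* [SerreTate1968] J.-P. Serre, J. Tate, *Good reduction of abelian varieties*, Ann. of Math. 88 (1968), §1 (integral models).
-/

set_option autoImplicit false

noncomputable section

-- Mathlib's `Over`/pull-back API is stated across semireducible wrappers (as in the ★ `Limits/*` and `Motives/IntegralModel*` files).
set_option backward.isDefEq.respectTransparency false

universe u

open CategoryTheory CategoryTheory.Limits AlgebraicGeometry MonoidalCategory CartesianMonoidalCategory

/-! ### §1 A `Spec K`-morphism `Y ⊗ Spec K → P ⊗ Spec K` is the generic value of a `D(t)`-morphism (EGA IV₃ 8.8.2 (i)) -/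

namespace Literature.AlgebraicGeometry.Limits

namespace LocApprox

open Literature.AlgebraicGeometry.Motives (SchemeOver specOver)

variable {A : Type u} [CommRing A] (S : Submonoid A) (B : Type u) [CommRing B] [Algebra A B] [IsLocalization S B]
variable {Y P : SchemeOver A}

/-- **An `A`-morphism `a : Y ⊗ Spec B → P` spreads to a `D(t)`-morphism `h : Y ⊗ D(t) → P ⊗ D(t)` with `(Y ◁ leg_t) ≫ h ≫ pr₁ = a`**
(`Y` quasi-compact quasi-separated, `P` locally of finite presentation over `A`; `B = A_S`): ★ `exists_whiskerLeft_comp_eq` (Stacks 01ZC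
surjectivity for the diagram `Y ⊗ D(t)`) gives `g : Y ⊗ D(t) → P` with `(Y ◁ leg_t) ≫ g = a`, and `h := overStage g` pairs it with the
projection. [cite: EGAIV3, Thm. 8.8.2 (i) (p. 28)] [cite: StacksProject, Tag 01ZC] [cite: GortzWedhorn2020, Thm. 10.63 (p. 328)] -/
theorem exists_stage_hom_of_generic_fst [QuasiCompact Y.hom] [QuasiSeparated Y.hom] [LocallyOfFinitePresentation P.hom]
    (a : Y ⊗ specOver A B ⟶ P) :
    ∃ (t : Idx S) (h : Y ⊗ (baseDiagram S).obj t ⟶ P ⊗ (baseDiagram S).obj t),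
      h ≫ snd _ _ = snd _ _ ∧ (Y ◁ leg S B t) ≫ h ≫ fst _ _ = a := by
  obtain ⟨t, g, hg⟩ := exists_whiskerLeft_comp_eq B (S := S) (P := Y) (X := P) a
  exact ⟨t, overStage g, overStage_snd g, by rw [overStage_fst]; exact hg⟩

/-- **EGA IV₃ 8.8.2 (i), «given generic value» form.**  For `Y → Spec A` quasi-compact quasi-separated and `P → Spec A` locally of finite
presentation, every morphism `h_B : Y ⊗ Spec B → P ⊗ Spec B` OVER `Spec B` (`h_B ≫ pr₂ = pr₂`) is the generic value of a morphism
`h : Y ⊗ D(t) → P ⊗ D(t)` OVER `D(t)` for some stage `t`: `(Y ◁ leg_t) ≫ h = h_B ≫ (P ◁ leg_t)` (★ `exists_whiskerLeft_comp_eq` on the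
first component `h_B ≫ pr₁`, ★ `whiskerLeft_π_overStage` for the pairing).  Uniqueness at a finer stage: ★ `exists_stage_res_eq_res`.
[cite: EGAIV3, Thm. 8.8.2 (i) (p. 28)] [cite: StacksProject, Tag 01ZC] [cite: GortzWedhorn2020, Thm. 10.63 (p. 328)] -/
theorem exists_stage_hom_of_generic [QuasiCompact Y.hom] [QuasiSeparated Y.hom] [LocallyOfFinitePresentation P.hom]
    (hB : Y ⊗ specOver A B ⟶ P ⊗ specOver A B) (hhB : hB ≫ snd _ _ = snd _ _) :
    ∃ (t : Idx S) (h : Y ⊗ (baseDiagram S).obj t ⟶ P ⊗ (baseDiagram S).obj t),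
      h ≫ snd _ _ = snd _ _ ∧ (Y ◁ leg S B t) ≫ h = hB ≫ (P ◁ leg S B t) := by
  obtain ⟨t, g, hg⟩ := exists_whiskerLeft_comp_eq B (S := S) (P := Y) (X := P) (hB ≫ fst P (specOver A B))
  exact ⟨t, overStage g, overStage_snd g, whiskerLeft_π_overStage (B := B) g hB hhB hg⟩

/-- The first-component reading of `exists_stage_hom_of_generic` on underlying schemes: the generic value of `h ≫ pr₁` is `h_B ≫ pr₁`.
[cite: EGAIV3, Thm. 8.8.2 (i) (p. 28)] [cite: GortzWedhorn2020, Thm. 10.63 (p. 328)] -/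
theorem whiskerLeft_leg_left_comp_left_comp_fst {t : Idx S} (h : Y ⊗ (baseDiagram S).obj t ⟶ P ⊗ (baseDiagram S).obj t)
    (hB : Y ⊗ specOver A B ⟶ P ⊗ specOver A B) (hc : (Y ◁ leg S B t) ≫ h = hB ≫ (P ◁ leg S B t)) :
    (Y ◁ leg S B t).left ≫ h.left ≫ pullback.fst P.hom ((baseDiagram S).obj t).hom =
      hB.left ≫ pullback.fst P.hom (specOver A B).hom := by
  have e : ((Y ◁ leg S B t) ≫ h ≫ fst _ _).left = (hB ≫ (P ◁ leg S B t) ≫ fst _ _).left := by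
    rw [← Category.assoc, hc, Category.assoc]
  rw [whiskerLeft_fst] at e
  simpa only [Over.comp_left, Over.fst_left, Category.assoc] using e

end LocApprox

end Literature.AlgebraicGeometry.Limits

/-! ### §2 The sheet structure `𝓜.total ⊗ D(t) → Spec B ⊗ D(t)` of a model of a restricted scheme -/

namespace Literature.AlgebraicGeometry.Motives

namespace IntegralModel

open Literature.AlgebraicGeometry.Limits.LocApprox (Idx baseDiagram leg exists_stage_hom_of_generic_fst)

section Sheet

variable {A K B L : Type} [CommRing A] [Field K] [Algebra A K] [CommRing B] [Field L] [Algebra B L]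
  [Algebra A B] [Algebra K L] [Algebra A L] [IsScalarTower A B L] [IsScalarTower A K L]
  (S : Submonoid A) [IsLocalization S K] {Z : SchemeOver L}

/-- **The generic sheet structure is a morphism over `Spec A`.**  For a model `𝓜` over `A` of `Z` regarded over `K`, the composite
`𝓜.total ×_A Spec K ≅ Z → Spec L → Spec B` followed by `Spec B → Spec A` is the structure morphism `pr₁ ≫ (𝓜.total → Spec A)` of
`𝓜.total ⊗ Spec K` (the square `A → B → L = A → K → L` and `Over.w` of the generic isomorphism). [cite: GortzWedhorn2020, Prop. 4.16 and §(4.8)]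
[cite: SerreTate1968, §1] -/
theorem genericIso_hom_left_comp_sheet_comp_specMap (𝓜 : IntegralModel A K (SchemeOver.restrictScalars K Z)) :
    (𝓜.genericIso.hom.left ≫ Z.hom ≫ Spec.map (CommRingCat.ofHom (algebraMap B L))) ≫ (specOver A B).hom =
      (𝓜.total ⊗ specOver A K).hom := by
  have hw : 𝓜.genericIso.hom.left ≫ Z.hom ≫ Spec.map (CommRingCat.ofHom (algebraMap K L)) =
      pullback.snd 𝓜.total.hom (Spec.map (CommRingCat.ofHom (algebraMap A K))) :=
    Over.w 𝓜.genericIso.hom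
  change (𝓜.genericIso.hom.left ≫ Z.hom ≫ Spec.map (CommRingCat.ofHom (algebraMap B L))) ≫
      Spec.map (CommRingCat.ofHom (algebraMap A B)) = _
  rw [Over.tensorObj_hom, pullback.condition]
  simp only [Category.assoc]
  rw [specMap_algebraMap_comp, ← specMap_algebraMap_comp (A := A) (R := K) (K := L), reassoc_of% hw]
  rfl

/-- **THE SHEET STRUCTURE AT A STAGE.**  Let `𝓜` be an integral model over `A` of an `L`-scheme `Z` regarded over `K` (`K = A_S`), with
`𝓜.total → Spec A` quasi-compact and quasi-separated and `Spec B → Spec A` locally of finite presentation.  Then for some stage `t` there is a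
morphism `h : 𝓜.total ⊗ D(t) → Spec B ⊗ D(t)` OVER `D(t)` whose generic value, composed with the projection to `Spec B`, is the sheet structure
of the generic fibre read through the model's own generic isomorphism: `(𝓜.total ◁ leg_t) ≫ h ≫ pr₁ = 𝓜.genericIso ≫ (Z → Spec L → Spec B)` on
underlying schemes (§1 applied to that `A`-morphism). [cite: EGAIV3, Thm. 8.8.2 (i) (p. 28)] [cite: GortzWedhorn2020, Thm. 10.63 (p. 328); Prop. 4.16 and §(4.8)]
[cite: SerreTate1968, §1] -/
theorem exists_stage_sheetStructure (𝓜 : IntegralModel A K (SchemeOver.restrictScalars K Z))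
    [QuasiCompact 𝓜.total.hom] [QuasiSeparated 𝓜.total.hom] [LocallyOfFinitePresentation (specOver A B).hom] :
    ∃ (t : Idx S) (h : 𝓜.total ⊗ (baseDiagram S).obj t ⟶ specOver A B ⊗ (baseDiagram S).obj t),
      h ≫ snd _ _ = snd _ _ ∧
      (𝓜.total ◁ leg S K t).left ≫ h.left ≫ pullback.fst (specOver A B).hom ((baseDiagram S).obj t).hom =
        𝓜.genericIso.hom.left ≫ Z.hom ≫ Spec.map (CommRingCat.ofHom (algebraMap B L)) := by
  -- the generic sheet structure as an `A`-morphism `𝓜.total ⊗ Spec K ⟶ Spec B`, spread by §1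
  obtain ⟨t, h, hh, hc⟩ := exists_stage_hom_of_generic_fst S K (Y := 𝓜.total) (P := specOver A B)
    (Over.homMk (𝓜.genericIso.hom.left ≫ Z.hom ≫ Spec.map (CommRingCat.ofHom (algebraMap B L)))
      (genericIso_hom_left_comp_sheet_comp_specMap 𝓜))
  refine ⟨t, h, hh, ?_⟩
  have e := congrArg CommaMorphism.left hc
  simp only [Over.comp_left, Over.fst_left, Over.homMk_left] at e
  exact e

end Sheet

/-! ### §3 Number fields: `A = 𝓞 F`, `K = F`, `B = 𝓞 Fᵢ`, `L = Fᵢ`; the thickening form -/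

section NumberField

open scoped NumberField

variable {F Fi : Type} [Field F] [NumberField F] [Field Fi] [NumberField Fi] [Algebra F Fi]

/-- **The `𝓞 Fᵢ`-structure of a model of `Z∕Fᵢ` regarded over `F`, at a stage of `Spec 𝓞 F`** (§2 with `A = 𝓞 F`, `K = F`, `B = 𝓞 Fᵢ`,
`L = Fᵢ`, `S = (𝓞 F)⁰`; `Spec 𝓞 Fᵢ → Spec 𝓞 F` is locally of finite presentation by ★ `locallyOfFinitePresentation_specMap_ringOfIntegers`).
[cite: EGAIV3, Thm. 8.8.2 (i) (p. 28)] [cite: SerreTate1968, §1] -/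
theorem exists_stage_sheetStructure_ringOfIntegers {Z : SchemeOver Fi} (𝓜 : IntegralModel (𝓞 F) F (SchemeOver.restrictScalars F Z))
    [QuasiCompact 𝓜.total.hom] [QuasiSeparated 𝓜.total.hom] :
    ∃ (t : Idx (nonZeroDivisors (𝓞 F)))
      (h : 𝓜.total ⊗ (baseDiagram (nonZeroDivisors (𝓞 F))).obj t ⟶ specOver (𝓞 F) (𝓞 Fi) ⊗ (baseDiagram (nonZeroDivisors (𝓞 F))).obj t),
      h ≫ snd _ _ = snd _ _ ∧
      (𝓜.total ◁ leg (nonZeroDivisors (𝓞 F)) F t).left ≫ h.left ≫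
          pullback.fst (specOver (𝓞 F) (𝓞 Fi)).hom ((baseDiagram (nonZeroDivisors (𝓞 F))).obj t).hom =
        𝓜.genericIso.hom.left ≫ Z.hom ≫ Spec.map (CommRingCat.ofHom (algebraMap (𝓞 Fi) Fi)) := by
  haveI : LocallyOfFinitePresentation (specOver (𝓞 F) (𝓞 Fi)).hom :=
    locallyOfFinitePresentation_specMap_ringOfIntegers (F := F) (Fi := Fi)
  exact exists_stage_sheetStructure (nonZeroDivisors (𝓞 F)) 𝓜

/-- **THE THICKENING FORM (the P-LINE's binder shape).**  For a global model `𝓜 : IntegralModel (𝓞 F) F ((thickening F Fᵢ).obj X)` of the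
Galois thickening `X ⊗_F Fᵢ` regarded over `F` (quasi-compact quasi-separated total space) there are a stage `t` and a `D(t)`-morphism
`h : 𝓜.total ⊗ D(t) → Spec 𝓞 Fᵢ ⊗ D(t)` whose generic value composed with `pr₁` is `𝓜.genericIso ≫ pr₂ ≫ (Spec Fᵢ → Spec 𝓞 Fᵢ)`, `pr₂ :
X ×_F Spec Fᵢ → Spec Fᵢ` the sheet coordinate (`(thickening F Fᵢ).obj X = SchemeOver.restrictScalars F ((baseChange F Fᵢ).obj X)` by `rfl`,
★ `thickening_obj_eq_restrictScalars`). [cite: EGAIV3, Thm. 8.8.2 (i) (p. 28)] [cite: SerreTate1968, §1] [cite: GortzWedhorn2020, §(4.8)–(4.9)] -/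
theorem exists_stage_sheetStructure_thickening (X : SchemeOver F) (𝓜 : IntegralModel (𝓞 F) F ((thickening F Fi).obj X))
    [QuasiCompact 𝓜.total.hom] [QuasiSeparated 𝓜.total.hom] :
    ∃ (t : Idx (nonZeroDivisors (𝓞 F)))
      (h : 𝓜.total ⊗ (baseDiagram (nonZeroDivisors (𝓞 F))).obj t ⟶ specOver (𝓞 F) (𝓞 Fi) ⊗ (baseDiagram (nonZeroDivisors (𝓞 F))).obj t),
      h ≫ snd _ _ = snd _ _ ∧
      (𝓜.total ◁ leg (nonZeroDivisors (𝓞 F)) F t).left ≫ h.left ≫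
          pullback.fst (specOver (𝓞 F) (𝓞 Fi)).hom ((baseDiagram (nonZeroDivisors (𝓞 F))).obj t).hom =
        𝓜.genericIso.hom.left ≫ pullback.snd X.hom (AbelianVariety.bcSpec F Fi) ≫
          Spec.map (CommRingCat.ofHom (algebraMap (𝓞 Fi) Fi)) :=
  exists_stage_sheetStructure_ringOfIntegers (Z := (baseChange F Fi).obj X) 𝓜

end NumberField

end IntegralModel

end Literature.AlgebraicGeometry.Motives

end
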